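import Summits.QuantumFields.YangMills.Theorems.VirialFluxGapFixSplitDefs
import Summits.QuantumFields.YangMills.Theorems.VirialFluxGapAnchorChartDefs
import HarnessLib

/-!
# The SLICE MAP and the WINDOW MAP on the tree-gauged ring space — definitions
# (layer (B2) of the DIRECT Laplace road to ⟨stmt-QuantumFields-24204⟩ `VirialFluxGap.SharpTwistedLaplace`)

Problem-side definitions (free-hands work of width seat ym-line-sfw-p2-w3 g57, cell ym-idea-1; `--supports 24204`).  With the splitting
✓`FixSplit.fixSplit : X_fix ≃ᵐ (SU2 × SU2) × FixRest` (anchors: seam site `y₀`, off-tree link `e₀`) and the anchor slices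
✓`AnchorSlice.seamSlice` ∕ `linkSlice`:
* `RestParam L e₀ y₀` — the exponential coordinates of the remaining components (`ℝ³` per off-tree link `≠ e₀`, per link of each full
  slice, per seam site `≠ y₀`), with the product chart law `restParamMeasure` (`expMeasure` per component, ✓`T4HaarSU2ExpChart`);
* `restChart R k b` — the CONJUGATED LEFT EXPONENTIAL CHARTS `b ↦ (k·expPoint(b_i)·R_i·k⁻¹)_i` of the remaining components around their
  base values `R` (✓`ConjChart`);
* `fixSlice … R y` — THE SLICE MAP `σ : ℝ³ × RestParam → X_fix`: anchors through `seamSlice`, `linkSlice` (coordinates `y.1 = (t, b₁, b₂)`),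
  the rest through `restChart R 1`, re-assembled by `fixSplit.symm`;
* `fixWindowMap … R w` — THE WINDOW MAP `Θ'(z, y) = k·σ(y)·k⁻¹`, `k = expPoint z`, the residual constant gauge transformation acting as in
  ✓`VirialFluxGapFixGaugeAction`.
HONEST FRAMING: definitions only (no theorem, no `sorry`); nothing about ⟨24204⟩ is proved here; the Yang–Mills mass gap is NOT proved; no summit
is proved by a line.

## References
* G. E. Bredon, *Introduction to Compact Transformation Groups* (1972), Ch. II §§4–5. [Bredon1972]
* K. W. Breitung, *Asymptotic Approximations for Probability Integrals*, LNM 1592 (1994), §2.3 Definitions 4–5. [Breitung1994]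
-/

set_option autoImplicit false

noncomputable section

open MeasureTheory
open Literature.MathematicalPhysics.QuantumFieldTheory hiding SU2
open Literature.MathematicalPhysics.QuantumFieldTheory.Balaban1983to89.T4HaarSU2ExpChart
open Summit.QuantumFields.YangMills.Theorems.FemtoTransferGap
open Summit.QuantumFields.YangMills.Theorems.FemtoTransferGap.TT
open Summit.QuantumFields.YangMills.Theorems.VirialFluxGap.AnchorSlice

namespace Summit.QuantumFields.YangMills.Theorems.VirialFluxGap.FixSplit

variable (L : ℕ) [NeZero L]

/-- Exponential coordinates of the remaining components (`ℝ³` each). [cite: Breitung1994, §2.3 Definitions 4–5] -/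
abbrev RestParam (e₀ : OffIdx L) (y₀ : Site 3 L) : Type :=
  ({i : OffIdx L // ¬ i = e₀} → EuclideanSpace ℝ (Fin 3)) ×
    ((Fin (2 * L - 1) → Edge 3 L → EuclideanSpace ℝ (Fin 3)) × ({y : Site 3 L // ¬ y = y₀} → EuclideanSpace ℝ (Fin 3)))

/-- The product chart law on the remaining coordinates: `expMeasure` (`(2π²)⁻¹ sinc²‖·‖` on the ball of radius `π`) per component.
[cite: Breitung1994, §2.3 Definitions 4–5] -/
def restParamMeasure (e₀ : OffIdx L) (y₀ : Site 3 L) : Measure (RestParam L e₀ y₀) :=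
  (Measure.pi fun _ : {i : OffIdx L // ¬ i = e₀} => expMeasure).prod
    ((Measure.pi fun _ : Fin (2 * L - 1) => Measure.pi fun _ : Edge 3 L => expMeasure).prod
      (Measure.pi fun _ : {y : Site 3 L // ¬ y = y₀} => expMeasure))

variable {L}

/-- **Conjugated left exponential charts of the remaining components** around base values `R`: `b ↦ (k·expPoint(b_i)·R_i·k⁻¹)_i`.
[cite: Bredon1972, Ch. II §4] -/
def restChart {e₀ : OffIdx L} {y₀ : Site 3 L} (R : FixRest L e₀ y₀) (k : SU2) (b : RestParam L e₀ y₀) : FixRest L e₀ y₀ :=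
  (fun i => k * (expPoint (b.1 i) * R.1 i) * k⁻¹,
    (fun j e => k * (expPoint (b.2.1 j e) * R.2.1 j e) * k⁻¹, fun y => k * (expPoint (b.2.2 y) * R.2.2 y) * k⁻¹))

/-- **THE SLICE MAP** `σ(a, b) = fixSplit⁻¹((seamSlice a₀, linkSlice a₁ a₂), restChart R 1 b)` through the zero with anchors `C₀, N₀` and
remaining components `R`. [cite: Bredon1972, Ch. II §§4–5] -/
def fixSlice (ωC ωN ωX : EuclideanSpace ℝ (Fin 3)) (C₀ N₀ : SU2) {e₀ : OffIdx L} {y₀ : Site 3 L} (R : FixRest L e₀ y₀)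
    (y : EuclideanSpace ℝ (Fin 3) × RestParam L e₀ y₀) : FixSpace L :=
  (fixSplit L e₀ y₀).symm ((seamSlice ωC C₀ (y.1 0), linkSlice ωN ωX N₀ (y.1 1) (y.1 2)), restChart R 1 y.2)

/-- **THE WINDOW MAP** `Θ'(z, y) = k · σ(y) · k⁻¹`, `k = expPoint z` (the residual constant gauge transformation of
✓`VirialFluxGapFixGaugeAction` applied to the slice point). [cite: Bredon1972, Ch. II §§4–5] [cite: Breitung1994, §2.3 Definitions 4–5] -/
def fixWindowMap (ωC ωN ωX : EuclideanSpace ℝ (Fin 3)) (C₀ N₀ : SU2) {e₀ : OffIdx L} {y₀ : Site 3 L} (R : FixRest L e₀ y₀)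
    (w : EuclideanSpace ℝ (Fin 3) × (EuclideanSpace ℝ (Fin 3) × RestParam L e₀ y₀)) : FixSpace L :=
  ((fun i => expPoint w.1 * (fixSlice ωC ωN ωX C₀ N₀ R w.2).1 i * (expPoint w.1)⁻¹),
    ((fun j => gaugeTransform (fun _ : Site 3 L => expPoint w.1) ((fixSlice ωC ωN ωX C₀ N₀ R w.2).2.1 j)),
      (fun y => expPoint w.1 * (fixSlice ωC ωN ωX C₀ N₀ R w.2).2.2 y * (expPoint w.1)⁻¹)))

end Summit.QuantumFields.YangMills.Theorems.VirialFluxGap.FixSplit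

end
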